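import Literature.NumberTheory.ComplexMultiplication.CMTypeRealisationEisensteinCurve
import Literature.NumberTheory.ComplexMultiplication.CMTypeRealisationGaussianSquareInducedType
import HarnessLib

/-!
# The square of the Eisenstein curve over `ℚ(ζ₃)`; every CM type of `ℚ(ζ₁₂)` on a square (Shimura 1998 §6.2 Thm 3, `h = 2`)

Topic `Literature/NumberTheory/ComplexMultiplication` (namespace `Literature.NumberTheory.ComplexMultiplication`,
sub-namespaces `CMSquare`, `EisensteinCMSquare`); companion of `CMTypeRealisationGaussianSquare` (the square
`E × E` of the Gaussian curve over `ℚ(ζ₄)` is of type `(ℚ(ζ₈), Φ)` and `(ℚ(ζ₁₂), Φ′)`).  Lane `lit-hodgefound`,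
Layer-B carrier `IsCMTypeRealisationOver` (TRIBUNAL-B row B34).

THE PRINT (Shimura 1998 §6.2 THEOREM 3, type inflation, pp. 41–43): for a structure of type `(K; {ψⱼ})` and a
field `F ⊇ K` with `[F : K] = h`, the `h`-fold product carries a structure of type `(F; {φᵢ})`; «Moreover, if
`F` does not coincide with `K`, `A` is not simple».  HERE `K = ℚ(√-3) = ℚ(ζ₃)`, `F = ℚ(ζ₁₂) = K(i)`, `h = 2`,
on the ALGEBRAIC carrier over the number field `k = ℚ(ζ₃)`: the square `E′ × E′` of the Eisenstein curve
`E′ : y² + y = x³` (`CMTypeRealisationEisensteinCurve`, `EllipticCurves.J0.abelianVariety`, `[ω] : (x, y) ↦ (ζ₃x, y)`).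

* §1 (generic, any `A/k`): `CMSquare.rot4 = (0 −1; 1 0)` (`(P, Q) ↦ (−Q, P)`, `rot₄² = −1`, the companion
  matrix of `X² + 1` — multiplication by `i` on `𝔫 ⊕ 𝔫i`), commuting with every diagonal `u ⊕ u`;
  `CMSquare.rot12OfOmega u = rot₄ ≫ (u ⊕ u)` and **`aeval_rot12OfOmega_cyclotomic`**: `Φ₁₂(rot₄ ≫ (u ⊕ u)) = 0`
  whenever `u ≫ u + u + 𝟙 = 0` (`(Jδ)² = −δ²`, `(Jδ)⁴ = δ⁴ = δ`, so `Φ₁₂(Jδ) = δ + δ² + 1 = 0`) — the mirror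
  image of `rot12Of` (`rot₃ ≫ (ι ⊕ ι)`, `ι² = −1`) of the Gaussian file;
* §2 `EisensteinCMSquare.iota₁₂ : ℤ[ζ₁₂] → End_k(E′ × E′)`, `ζ₁₂ ↦ rot₄ ≫ ([ω] ⊕ [ω])`, and
  **`exists_isCMTypeRealisationOver_twelve : ∃ Φ : CMType ℚ(ζ₁₂), IsCMTypeRealisationOver Φ (E′ × E′) ι₁₂`**
  (Shimura §5.2 over `k`: `CMSquare.exists_isCMTypeRealisationOver_iotaOfCyclotomic`, `2 · dim = 4 = φ(12)`);
  `not_isSimple_baseChange` (the type is not primitive — `GaussianCMSquare.not_isPrimitive_twelve` — hence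
  `(E′ × E′) ⊗ ℂ` is not simple: the last clause of Thm 3);
* §1′ (generic) **`CMSquare.cmType_eq_inducedCMType_of_finrank_eq_two`** — GENERAL FORM of the type
  identification in Thm 3 for `h = 2`: for an elliptic curve `A/k` with a structure `ι₁` of imaginary-quadratic
  type `(K₀, Φ₁)` and a `K`-structure `ι` on `A × A` extending the diagonal one (`ι(j b) = ι₁(b) ⊕ ι₁(b)` for a
  separating `b`), the type of `(A × A, ι)` is `Φ₁^K` (Künneth-free, via `complexBetti_map_diagEnd_eq_smul_of_forall`
  of `CMTypeRealisationGaussianSquareInducedType`); §2′ `EisensteinCMSquare.jEmb₃ : ℚ(ζ₃) → ℚ(ζ₁₂)`, `ζ₃ ↦ ζ₁₂⁴`,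
  **`cmType_eq_inducedCMType`** (the type of `(E′ × E′, ι₁₂)` is `Φ₁^{ℚ(ζ₁₂)}`),
  `exists_isCMTypeRealisationOver_inducedCMType`;
* §3 `exists_isCMTypeRealisationOver_dim_two_of_sqrt_neg_three` — a structure of type `(ℚ(ζ₁₂), Φ)` over
  `ℚ(ζ₃)` of dimension `2` with `K ≠ k`, non-simple complexification, on the tree's carrier: TOGETHER with
  `exists_isCMTypeRealisationOver_dim_two` (`E × E` over `ℚ(ζ₄)`, `K = ℚ(ζ₈)`) and
  `GaussianCMSquare.exists_isCMTypeRealisationOver_twelve` (`K = ℚ(ζ₁₂)` over `ℚ(ζ₄)`), structures of type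
  `(ℚ(ζ₁₂), ·)` now exist over BOTH imaginary quadratic subfields `ℚ(i)`, `ℚ(√-3)` of `ℚ(ζ₁₂)`;
* §4 **every CM type `Ψ` of `ℚ(√-3)` (resp. `ℚ(i)`) inflates**: for ANY structure `ι₁` of type `Ψ` on `E′` (resp. `E`)
  the square carries `ζ₁₂ ↦ rot₄ ≫ (ι₁(ζ₃) ⊕ ι₁(ζ₃))` (resp. `rot₃ ≫ (ι₁(ζ₄) ⊕ ι₁(ζ₄))`) realising `Ψ^{ℚ(ζ₁₂)}`
  (`EisensteinCMSquare.exists_isCMTypeRealisationOver_inducedCMType_of`,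
  `GaussianCMSquare.exists_isCMTypeRealisationOver_inducedCMType_twelve_of`, and the `∀ Ψ` forms);
* §5 `CyclotomicTwelve.exists_eq_inducedCMType_or` — every CM type of `ℚ(ζ₁₂)` is induced from `ℚ(i)` or from
  `ℚ(√-3)` (Shimura §8.4 Example (2)(A), with the inclusions named), and the headline
  **`forall_cmType_twelve_exists_isCMTypeRealisationOver`: EVERY CM type of `ℚ(ζ₁₂)` is realised over a number
  field on `E × E / ℚ(ζ₄)` or on `E′ × E′ / ℚ(ζ₃)`** — Theorem 3 (`h = 2`) for `F = ℚ(ζ₁₂)` in full;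
* §6 the `ℚ(ζ₈)` companion: every CM type of `ℚ(i)` inflates along `ζ₄ ↦ ζ₈²` to a structure on `E × E` for ANY
  `ι₁` (`GaussianCMSquare.exists_isCMTypeRealisationOver_inducedCMType_eight_of` and its `∀ Ψ` form) — the two
  CM types of `ℚ(ζ₈)` induced from `ℚ(i)` (the two induced from `ℚ(√-2)` are not asserted).

Everything is a definition with a body or a theorem; no named fact (D-0026); axioms standard.  LOCAL
instances as in the sibling files.

## References

* [Shimura1998] G. Shimura, *Abelian Varieties with Complex Multiplication and Modular Functions* (1998), §6.2
  Theorem 3 with proof (pp. 41–43), §5.2, §8.2 Prop. 26, §8.4 Example (2)(A), §19.7.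
* [SilvermanAEC2009] J. H. Silverman, *The Arithmetic of Elliptic Curves*, 2nd ed. (2009), III.10.1, App. C §11
  Example 11.3.1.
* [Streng2010] M. Streng, *Complex multiplication of abelian surfaces* (2010), Ch. I Def. 3.2 (induced CM type).
* [Kieffer2024IsogenyGraphs] J. Kieffer, *Isogeny graphs of abelian varieties* (2024), §1.2.2 p. 22
  (`End(A × B)` as matrices). [MumfordAV1970] D. Mumford, *Abelian Varieties* (1970), §19.
-/

noncomputable section

open Polynomial NumberField CategoryTheory IsCyclotomicExtension
open Literature.AlgebraicGeometry.Motives (AbelianVariety CMType)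
open Literature.AlgebraicGeometry.ComplexMultiplication (IsCMTypeRealisation)
open Literature.NumberTheory.EllipticCurves

universe u

namespace Literature.NumberTheory.ComplexMultiplication

/-! ## §1 Generic: `rot₄ = (0 −1; 1 0)` and `Φ₁₂(rot₄ ≫ (u ⊕ u)) = 0` when `u² + u + 1 = 0` -/

namespace CMSquare

open Literature.AlgebraicGeometry.Motives.AbelianVariety (fst snd prodLift prodLift_fst prodLift_snd prod_hom_ext)

section Generic

variable {k : Type u} [Field k] (A : AbelianVariety k)

/-- **`rot₄ = (0 −1; 1 0)` on `A × A`: `(P, Q) ↦ (−Q, P)`** — the companion matrix of `X² + 1`, i.e.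
multiplication by `i` on `𝔫 ⊕ 𝔫i` (Shimura's `S(i)` for `F = K(i)`, basis `γ = (1, i)`), a `k`-RATIONAL
endomorphism of order `4` of any square. [cite: Shimura1998, §6.2 Theorem 3, proof (p0054 L5)]
[cite: Kieffer2024IsogenyGraphs, §1.2.2 p. 22] -/
def rot4 : A.prod A ⟶ A.prod A :=
  prodLift (-snd A A) (fst A A)

/-- `rot₄ ≫ pr₁ = −pr₂` (first row `(0 −1)`). [cite: Kieffer2024IsogenyGraphs, §1.2.2 p. 22] [cite: MumfordAV1970, §19 (p. 173)] -/
@[reassoc (attr := simp)]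
theorem rot4_fst : rot4 A ≫ fst A A = -snd A A :=
  prodLift_fst _ _

/-- `rot₄ ≫ pr₂ = pr₁` (second row `(1 0)`). [cite: Kieffer2024IsogenyGraphs, §1.2.2 p. 22] [cite: MumfordAV1970, §19 (p. 173)] -/
@[reassoc (attr := simp)]
theorem rot4_snd : rot4 A ≫ snd A A = fst A A :=
  prodLift_snd _ _

/-- **`rot₄² = −1`** (`(0 −1; 1 0)² = −1`: `i² = −1`). [cite: Shimura1998, §6.2 Theorem 3, proof]
[cite: Kieffer2024IsogenyGraphs, §1.2.2 p. 22] -/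
theorem rot4_comp_rot4 : rot4 A ≫ rot4 A = -𝟙 (A.prod A) :=
  prod_hom_ext
    (by rw [Category.assoc, rot4_fst, Preadditive.comp_neg, rot4_snd, Preadditive.neg_comp, Category.id_comp])
    (by rw [Category.assoc, rot4_snd, rot4_fst, Preadditive.neg_comp, Category.id_comp])

/-- **`rot₄` commutes with every diagonal endomorphism `u ⊕ u`** (integer matrix vs. the diagonal action).
[cite: Shimura1998, §6.2 Theorem 3, proof] [cite: Kieffer2024IsogenyGraphs, §1.2.2 p. 22] -/
theorem rot4_comp_diagEnd (f : A ⟶ A) : rot4 A ≫ diagEnd A f = diagEnd A f ≫ rot4 A :=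
  prod_hom_ext
    (by rw [Category.assoc, diagEnd_fst, rot4_fst_assoc, Category.assoc, rot4_fst, Preadditive.neg_comp,
      Preadditive.comp_neg, diagEnd_snd])
    (by rw [Category.assoc, diagEnd_snd, rot4_snd_assoc, Category.assoc, rot4_snd, diagEnd_fst])

/-- `(f ⊕ f) + (g ⊕ g) = (f + g) ⊕ (f + g)` (sum of diagonal matrices). [cite: Kieffer2024IsogenyGraphs, §1.2.2 p. 22]
[cite: MumfordAV1970, §19 (p. 173)] -/
theorem diagEnd_add (f g : A ⟶ A) : diagEnd A f + diagEnd A g = diagEnd A (f + g) :=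
  prod_hom_ext (by rw [Preadditive.add_comp, diagEnd_fst, diagEnd_fst, diagEnd_fst, Preadditive.comp_add])
    (by rw [Preadditive.add_comp, diagEnd_snd, diagEnd_snd, diagEnd_snd, Preadditive.comp_add])

/-- `𝟙 ⊕ 𝟙 = 𝟙`. [cite: Kieffer2024IsogenyGraphs, §1.2.2 p. 22] [cite: MumfordAV1970, §19 (p. 173)] -/
theorem diagEnd_id : diagEnd A (𝟙 A) = 𝟙 (A.prod A) :=
  prod_hom_ext (by rw [diagEnd_fst, Category.comp_id, Category.id_comp])
    (by rw [diagEnd_snd, Category.comp_id, Category.id_comp])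

/-- `0 ⊕ 0 = 0`. [cite: Kieffer2024IsogenyGraphs, §1.2.2 p. 22] [cite: MumfordAV1970, §19 (p. 173)] -/
theorem diagEnd_zero : diagEnd A (0 : A ⟶ A) = 0 :=
  prod_hom_ext (by rw [diagEnd_fst, Limits.comp_zero, Limits.zero_comp])
    (by rw [diagEnd_snd, Limits.comp_zero, Limits.zero_comp])

/-- **`rot₁₂^ω = rot₄ ≫ (u ⊕ u)` on `A × A`: `(P, Q) ↦ (−uQ, uP)`** — multiplication by the primitive `12`-th root of
unity `i · ζ₃` on `𝔫 ⊕ 𝔫i` when `u = [ζ₃]` (`F = K(i) = ℚ(ζ₁₂)` over `K = ℚ(ζ₃)`); the mirror image of `rot12Of`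
(`rot₃ ≫ (ι ⊕ ι)`, `ι² = −1`, `F = ℚ(i)(ζ₃)`). [cite: Shimura1998, §6.2 Theorem 3, proof (p0054 L5, p0056 L1)] -/
def rot12OfOmega (u : A ⟶ A) : A.prod A ⟶ A.prod A :=
  rot4 A ≫ diagEnd A u

/-- `(u ⊕ u)² + (u ⊕ u) + 1 = 0` in `End(A × A)` when `u ≫ u + u + 𝟙 = 0` (diagonal matrices form a ring
homomorphic image of `End A`). [cite: Kieffer2024IsogenyGraphs, §1.2.2 p. 22] [cite: MumfordAV1970, §19 (p. 173)] -/
theorem diagEnd_sq_add_diagEnd_add_one {u : A ⟶ A} (hu : u ≫ u + u + 𝟙 A = 0) :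
    (show End (A.prod A) from diagEnd A u) ^ 2 + (show End (A.prod A) from diagEnd A u) + 1 = 0 := by
  rw [sq, End.mul_def, diagEnd_comp_diagEnd]
  change diagEnd A (u ≫ u) + diagEnd A u + 𝟙 (A.prod A) = 0
  rw [← diagEnd_id, diagEnd_add, diagEnd_add, hu, diagEnd_zero]

/-- `(u ⊕ u)³ = 1` in `End(A × A)` when `u ≫ u + u + 𝟙 = 0` (`X³ − 1 = (X − 1)(X² + X + 1)`).
[cite: Kieffer2024IsogenyGraphs, §1.2.2 p. 22] [cite: MumfordAV1970, §19 (p. 173)] -/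
theorem diagEnd_pow_three {u : A ⟶ A} (hu : u ≫ u + u + 𝟙 A = 0) :
    (show End (A.prod A) from diagEnd A u) ^ 3 = 1 := by
  set δ : End (A.prod A) := diagEnd A u
  have e : δ ^ 3 - 1 = (δ - 1) * (δ ^ 2 + δ + 1) := by noncomm_ring
  rwa [diagEnd_sq_add_diagEnd_add_one A hu, mul_zero, sub_eq_zero] at e

/-- `(rot₁₂^ω)² = −(u ⊕ u)²` (`(Jδ)² = J²δ² = −δ²`, `J = rot₄` commuting with `δ = u ⊕ u`).
[cite: Shimura1998, §6.2 Theorem 3, proof] [cite: Kieffer2024IsogenyGraphs, §1.2.2 p. 22] -/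
theorem rot12OfOmega_sq (u : A ⟶ A) :
    (show End (A.prod A) from rot12OfOmega A u) ^ 2 = -(show End (A.prod A) from diagEnd A u) ^ 2 := by
  set δ : End (A.prod A) := diagEnd A u with hδ
  set J : End (A.prod A) := rot4 A with hJ
  have hx : (show End (A.prod A) from rot12OfOmega A u) = δ * J := rfl
  have hcomm : Commute δ J := by
    change (rot4 A ≫ diagEnd A u : A.prod A ⟶ A.prod A) = diagEnd A u ≫ rot4 A
    exact rot4_comp_diagEnd A u
  have hJ2 : J ^ 2 = -1 := by
    rw [sq, hJ, End.mul_def, rot4_comp_rot4]; rfl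
  rw [hx, hcomm.mul_pow, hJ2, mul_neg_one]

/-- **`(rot₁₂^ω)⁴ = u ⊕ u`** when `u ≫ u + u + 𝟙 = 0` (`(Jδ)⁴ = δ⁴ = δ`; with `u = [ζ₃]`: `ζ₁₂⁴ = ζ₃` acting
diagonally). [cite: Shimura1998, §6.2 Theorem 3, proof] [cite: Kieffer2024IsogenyGraphs, §1.2.2 p. 22] -/
theorem rot12OfOmega_pow_four {u : A ⟶ A} (hu : u ≫ u + u + 𝟙 A = 0) :
    (show End (A.prod A) from rot12OfOmega A u) ^ 4 = (show End (A.prod A) from diagEnd A u) := by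
  rw [show (4 : ℕ) = 2 * 2 by norm_num, pow_mul, rot12OfOmega_sq, neg_sq, ← pow_mul,
    show (2 * 2 : ℕ) = 3 + 1 by norm_num, pow_succ, diagEnd_pow_three A hu, one_mul]

/-- `Φ₁₂(rot₁₂^ω) = (rot₁₂^ω)⁴ − (rot₁₂^ω)² + 1 = 0` in `End(A × A)` when `u ≫ u + u + 𝟙 = 0` (as the polynomial
`X⁴ − X² + 1`): `(Jδ)⁴ − (Jδ)² + 1 = δ + δ² + 1 = 0`. [cite: Shimura1998, §6.2 Theorem 3, proof]
[cite: Kieffer2024IsogenyGraphs, §1.2.2 p. 22] -/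
theorem aeval_rot12OfOmega_X_pow_four_sub_X_sq_add_one {u : A ⟶ A} (hu : u ≫ u + u + 𝟙 A = 0) :
    aeval (R := ℤ) (show End (A.prod A) from rot12OfOmega A u) (X ^ 4 - X ^ 2 + 1 : ℤ[X]) = 0 := by
  rw [map_add, map_sub, map_pow, map_pow, aeval_X, map_one, rot12OfOmega_pow_four A hu, rot12OfOmega_sq,
    sub_neg_eq_add, add_comm (show End (A.prod A) from diagEnd A u)]
  exact diagEnd_sq_add_diagEnd_add_one A hu

end Generic

/-- `Φ₁₂ = X⁴ − X² + 1` over `ℤ` (`Φ₁₂(X) = Φ₆(X²)`, `Φ₆ = X² − X + 1`). [folklore] -/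
private theorem cyclotomic_twelve' : cyclotomic 12 ℤ = X ^ 4 - X ^ 2 + 1 := by
  have h := (cyclotomic_expand_eq_cyclotomic Nat.prime_two (show 2 ∣ 6 by norm_num) ℤ).symm
  rw [show 6 * 2 = 12 by norm_num] at h
  rw [h, cyclotomic_six]
  simp [expand_X]
  ring

/-- **`Φ₁₂(rot₁₂^ω) = 0`** for `rot₁₂^ω = rot₄ ≫ (u ⊕ u)`, `u ≫ u + u + 𝟙 = 0`. [cite: Shimura1998, §6.2 Theorem 3, proof] -/
theorem aeval_rot12OfOmega_cyclotomic {k : Type u} [Field k] (A : AbelianVariety k) {u : A ⟶ A}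
    (hu : u ≫ u + u + 𝟙 A = 0) :
    aeval (R := ℤ) (show End (A.prod A) from rot12OfOmega A u) (cyclotomic 12 ℤ) = 0 := by
  rw [cyclotomic_twelve']; exact aeval_rot12OfOmega_X_pow_four_sub_X_sq_add_one A hu

/-! ### The type of a square with a `K`-structure extending a diagonal imaginary-quadratic structure -/

section InducedType

open Literature.AlgebraicGeometry.Motives.AbelianVariety (Hom.baseChange)
open Literature.AlgebraicGeometry.HodgeTheory (complexBetti IsOfHodgeType)
open Literature.NumberTheory.Automorphic.PicardCM (eigenline)

variable {k : Type} [Field k] [Algebra k ℂ] (A : AbelianVariety k)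

/-- Membership in a `σ`-eigenline: `θ(a) v = σ(a) • v` for all `a`. [folklore] -/
private theorem apply_eq_smul_of_mem_eigenline' {K M : Type*} [Field K] [AddCommGroup M] [Module ℂ M]
    {θ : K →+* Module.End ℂ M} {σ : K →+* ℂ} {v : M} (hv : v ∈ eigenline θ σ) (a : K) :
    θ a v = σ a • v := by
  have h := (Submodule.mem_iInf _).1 hv a
  exact Module.End.mem_eigenspace_iff.1 h

/-- A `σ`-eigenline of `finrank 1` contains a non-zero vector. [folklore] -/
private theorem exists_ne_zero_of_finrank_eq_one' {M : Type*} [AddCommGroup M] [Module ℂ M]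
    {S : Submodule ℂ M} (h : Module.finrank ℂ S = 1) : ∃ v ∈ S, v ≠ 0 := by
  by_contra! h0
  have hS : S = ⊥ := (Submodule.eq_bot_iff S).2 h0
  rw [hS, finrank_bot] at h
  exact zero_ne_one h

/-- Two field embeddings of `ℚ(ζₙ)` into `ℂ` agreeing at `ζₙ` are equal (`ℚ(ζₙ) = ℚ[ζₙ]`: Mathlib's power
basis `IsPrimitiveRoot.powerBasis`). [folklore] -/
private theorem ringHom_ext_of_apply_eq_of_isCyclotomicExtension {F : Type} [Field F] [NumberField F] {n : ℕ} [NeZero n]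
    [IsCyclotomicExtension {n} ℚ F] {ζ : F} (hζ : IsPrimitiveRoot ζ n) (τ τ' : F →+* ℂ)
    (h : τ (hζ.toInteger : F) = τ' (hζ.toInteger : F)) : τ = τ' := by
  have hζ' : (hζ.toInteger : F) = ζ := rfl
  rw [hζ'] at h
  have e : τ.toRatAlgHom = τ'.toRatAlgHom :=
    (hζ.powerBasis ℚ).algHom_ext (by
      rw [IsPrimitiveRoot.powerBasis_gen]
      exact h)
  exact RingHom.ext fun x => by simpa using congrArg (fun f : F →ₐ[ℚ] ℂ => f x) e

/-- **The type of `A × A` under a `K`-structure extending a diagonal imaginary-quadratic structure is the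
INDUCED type — GENERAL FORM of Shimura 1998 §6.2 Theorem 3 for `h = 2` on the algebraic carrier** («the `φᵢ` are
all the isomorphisms of `F` into `ℂ` inducing the `ψⱼ` on `K`»).  Let `(A, ι₁)` be a structure of type `(K₀, Φ₁)`
over `k` with `K₀` imaginary quadratic (`[K₀ : ℚ] = 2`; so `A` is an elliptic curve and `Φ₁ = {φ₁}`), let
`b ∈ 𝓞_{K₀}` separate the embeddings of `K₀` (e.g. a generator), and let `(A × A, ι)` be of type `(K, Φ)` over `k`
with `ι(a) = ι₁(b) ⊕ ι₁(b)` for some `a ∈ 𝓞_K` with `j(b) = a` (`j : K₀ → K`).  Then `Φ = Φ₁^K`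
(`inducedCMType j Φ₁`).  Proof, Künneth-free: `ι₁(b)^*` acts on the line `H^{1,0}(A_ℂ)` (the `φ₁`-eigenline)
by `φ₁(b)`, hence `(ι₁(b) ⊕ ι₁(b))^*` acts on `H^{1,0}((A × A)_ℂ)` by `φ₁(b)`
(`complexBetti_map_diagEnd_eq_smul_of_forall`); on a `σ`-eigenvector `v ≠ 0`, `σ ∈ Φ` (a `(1,0)`-class),
`ι(a)^* v = σ(a) v`, so `σ(j(b)) = φ₁(b)`, i.e. `σ ∘ j = φ₁`; maximality of CM types (`CMType.eq_of_subset`).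
[cite: Shimura1998, §6.2 Theorem 3 with proof (pp. 41–43; p0054 L3, p0055)] [cite: Streng2010, Ch. I Def. 3.2] -/
theorem cmType_eq_inducedCMType_of_finrank_eq_two {K₀ K : Type} [Field K₀] [NumberField K₀] [Field K]
    [NumberField K] {Φ₁ : CMType K₀} {Φ : CMType K} {ι₁ : 𝓞 K₀ →+* End A} {ι : 𝓞 K →+* End (A.prod A)}
    (h2 : Module.finrank ℚ K₀ = 2) {b : 𝓞 K₀}
    (hb : ∀ τ τ' : K₀ →+* ℂ, τ (b : K₀) = τ' (b : K₀) → τ = τ') (j : K₀ →+* K) {a : 𝓞 K}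
    (hja : j (b : K₀) = (a : K)) (hιa : ι a = diagEnd A (ι₁ b))
    (h₁ : IsCMTypeRealisationOver Φ₁ A ι₁) (h : IsCMTypeRealisationOver Φ (A.prod A) ι) :
    Φ = inducedCMType j Φ₁ := by
  classical
  obtain ⟨θ₁, hE⟩ := h₁
  obtain ⟨θ, hP⟩ := h
  -- `Φ₁ = {φ₁}`
  haveI : IsTotallyComplex K₀ := CMTypeLattice.isTotallyComplex_of_cmType Φ₁
  obtain ⟨φ₁, rfl⟩ := CMTypeCount.exists_eq_single h2 Φ₁
  have hφ₁ : φ₁ ∈ (CMTypeCount.single h2 φ₁).1 := by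
    rw [CMTypeCount.single_val]; exact Set.mem_singleton φ₁
  -- `dim (A ⊗ ℂ) = 1`
  have hd : Module.finrank ℚ K₀ / 2 = (A.baseChange ℂ).dim :=
    (Literature.AlgebraicGeometry.Motives.schemeDim_eq_holds hE.1).symm
  have hdimA : (A.baseChange ℂ).dim = 1 := by rw [← hd, h2]
  -- `ι₁(b)^*` is the scalar `φ₁(b)` on `H^{1,0}(A ⊗ ℂ)`
  have hc : ∀ w : complexBetti (A.baseChange ℂ).X 1,
      IsOfHodgeType (A.baseChange ℂ).dim (A.baseChange ℂ).X 1 1 0 w →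
        complexBetti.map (Hom.baseChange ℂ (ι₁ b)).hom.hom.hom 1 w = φ₁ (b : K₀) • w := by
    obtain ⟨ω, -, -, hgen⟩ :=
      Literature.AlgebraicGeometry.HodgeTheory.EllipticCurve.exists_hodgeOneZero_generator hdimA
    obtain ⟨v₁, hv₁, hv₁0⟩ := exists_ne_zero_of_finrank_eq_one' (hE.2.2.2 φ₁).1
    have hv₁10 := (hE.2.2.2 φ₁).2.1 hφ₁ v₁ hv₁
    rw [hd] at hv₁10
    obtain ⟨d₁, hd₁⟩ := hgen v₁ hv₁10
    have hd₁0 : d₁ ≠ 0 := fun h0 => hv₁0 (by rw [hd₁, h0, zero_smul])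
    have hθv₁ : complexBetti.map (Hom.baseChange ℂ (ι₁ b)).hom.hom.hom 1 v₁ = φ₁ (b : K₀) • v₁ := by
      have e := apply_eq_smul_of_mem_eigenline' hv₁ (b : K₀)
      have h3 := hE.2.2.1 b
      rw [RingHom.comp_apply, AbelianVariety.endBaseChange_apply] at h3
      rw [← h3] at e
      exact e
    have hω : ω = d₁⁻¹ • v₁ := by rw [hd₁, smul_smul, inv_mul_cancel₀ hd₁0, one_smul]
    intro w hw
    obtain ⟨d, rfl⟩ := hgen w hw
    rw [hω, map_smul, map_smul, hθv₁]
    simp only [smul_smul]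
    congr 1
    ring
  refine CMType.eq_of_subset fun σ hσ => ?_
  rw [mem_inducedCMType_iff]
  -- a non-zero `σ`-eigenvector `v`, of type `(1,0)`
  obtain ⟨v, hv, hv0⟩ := exists_ne_zero_of_finrank_eq_one' (hP.2.2.2 σ).1
  have hv10 := (hP.2.2.2 σ).2.1 hσ v hv
  -- `θ(a) = (ι₁(b) ⊕ ι₁(b)) ⊗ ℂ` on `H¹`
  have hθa : θ (a : K) = (complexBetti.map (Hom.baseChange ℂ (diagEnd A (ι₁ b))).hom.hom.hom 1).hom := by
    have h3 := hP.2.2.1 a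
    rw [RingHom.comp_apply, hιa, AbelianVariety.endBaseChange_apply] at h3
    exact h3.symm
  have hδ₁ : complexBetti.map (Hom.baseChange ℂ (diagEnd A (ι₁ b))).hom.hom.hom 1 v = σ (a : K) • v := by
    have e := apply_eq_smul_of_mem_eigenline' hv (a : K)
    rw [hθa] at e
    exact e
  have hδ₂ : complexBetti.map (Hom.baseChange ℂ (diagEnd A (ι₁ b))).hom.hom.hom 1 v = φ₁ (b : K₀) • v :=
    complexBetti_map_diagEnd_eq_smul_of_forall A hP.1 (ι₁ b) _ hc v hv10
  have hσa : σ (a : K) = φ₁ (b : K₀) := by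
    have e : (σ (a : K) - φ₁ (b : K₀)) • v = 0 := by rw [sub_smul, ← hδ₁, ← hδ₂, sub_self]
    rcases smul_eq_zero.1 e with h0 | h0
    · exact sub_eq_zero.1 h0
    · exact absurd h0 hv0
  have hτ : σ.comp j = φ₁ := hb _ _ (by rw [RingHom.comp_apply, hja, hσa])
  rw [hτ]
  exact hφ₁

end InducedType

end CMSquare

/-! ## §2 The square of the Eisenstein curve over `ℚ(ζ₃)` -/

namespace EisensteinCMSquare

open CMSquare

/-- `ℚ(ζ₃) = ℚ(√-3)` as Mathlib's `CyclotomicField 3 ℚ`. -/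
local notation "K₃" => CyclotomicField 3 ℚ
/-- `ℚ(ζ₁₂) = ℚ(i, √−3)`. -/
local notation "K₁₂" => CyclotomicField 12 ℚ

/-- `ℚ(ζ₃)/ℚ` is `{3}`-cyclotomic (LOCAL instance for the literal `3`). [folklore] -/
private theorem isCyclotomicExtension_three : IsCyclotomicExtension {3} ℚ K₃ :=
  CyclotomicField.isCyclotomicExtension 3 ℚ

/-- `ℚ(ζ₁₂)/ℚ` is `{12}`-cyclotomic (LOCAL instance). [folklore] -/
private theorem isCyclotomicExtension_twelve : IsCyclotomicExtension {12} ℚ K₁₂ :=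
  CyclotomicField.isCyclotomicExtension 12 ℚ

attribute [local instance] isCyclotomicExtension_three isCyclotomicExtension_twelve

attribute [local instance] EisensteinCMCurve.algebraComplex

/-- `3` is a unit of `ℚ(ζ₃)` (LOCAL instance, so that `y² + y = x³` is elliptic). [folklore] -/
private theorem fact_isUnit_three : Fact (IsUnit (3 : K₃)) := ⟨isUnit_iff_ne_zero.mpr three_ne_zero⟩

attribute [local instance] fact_isUnit_three

/-- The Eisenstein curve `E′ : y² + y = x³` over `k = ℚ(ζ₃)` as an abelian variety (the carrier of
`CMTypeRealisationEisensteinCurve`). -/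
local notation "E′" => J0.abelianVariety (CyclotomicField 3 ℚ)

/-- `[ω] : E′ → E′`, `[ω] ≫ [ω] + [ω] + 𝟙 = 0` (`EllipticCurves.J0.mulOmega` at `ζ₃`). -/
local notation "mulω" => J0.mulOmega (K := CyclotomicField 3 ℚ) EisensteinCMCurve.zeta_sq_add_zeta_add_one

/-- `[ℚ(ζ₁₂) : ℚ] = 4`. [folklore] -/
private theorem finrank_twelve : Module.finrank ℚ K₁₂ = 4 := by
  rw [IsCyclotomicExtension.finrank K₁₂ (cyclotomic.irreducible_rat (n := 12) (by norm_num))]; decide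

/-- **`dim (E′ × E′) = 2`** (`n = mh`, `m = 1`, `h = 2`). [cite: Shimura1998, §6.2 Theorem 3, proof (p0054 L5)] -/
theorem dim_prod : (AbelianVariety.prod E′ E′).dim = 2 := by
  rw [AbelianVariety.dim_prod, J0.dim_abelianVariety]

/-- `2 · dim (E′ × E′) = 4 = φ(12)`. [cite: Shimura1998, §5.2 (`[F : ℚ] = 2n`)] -/
theorem two_mul_dim_prod_eq_totient_twelve : 2 * (AbelianVariety.prod E′ E′).dim = Nat.totient 12 := by
  rw [dim_prod]; decide

/-- `Φ₁₂(rot₁₂^ω) = 0` in `End_k(E′ × E′)` for the Eisenstein curve (`[ω] ≫ [ω] + [ω] + 𝟙 = 0`,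
`J0.mulOmega_comp_mulOmega_add`). [cite: Shimura1998, §6.2 Theorem 3, proof] [cite: SilvermanAEC2009, App. C §11 Example 11.3.1] -/
theorem aeval_rot12_cyclotomic :
    aeval (R := ℤ) (show End (AbelianVariety.prod E′ E′) from rot12OfOmega E′ mulω) (cyclotomic 12 ℤ) = 0 :=
  aeval_rot12OfOmega_cyclotomic E′ (J0.mulOmega_comp_mulOmega_add EisensteinCMCurve.zeta_sq_add_zeta_add_one)

/-- **`ι₁₂ : ℤ[ζ₁₂] → End_k(E′ × E′)`, `ζ₁₂ ↦ rot₄ ≫ ([ω] ⊕ [ω])`** — the `𝓞_{ℚ(ζ₁₂)}`-structure of `E′ × E′` over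
`k = ℚ(ζ₃)`. [cite: Shimura1998, §6.2 Theorem 3] -/
def iota₁₂ : 𝓞 K₁₂ →+* End (AbelianVariety.prod E′ E′) :=
  iotaOfCyclotomic (zeta_spec 12 ℚ K₁₂) (AbelianVariety.prod E′ E′) aeval_rot12_cyclotomic

/-- `ι₁₂(ζ₁₂) = rot₄ ≫ ([ω] ⊕ [ω])`. [cite: Shimura1998, §6.2 Theorem 3] -/
theorem iota₁₂_toInteger_zeta : iota₁₂ (zeta_spec 12 ℚ K₁₂).toInteger = rot12OfOmega E′ mulω :=
  iotaOfCyclotomic_toInteger _ _ _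

/-- **`(E′ × E′, ι₁₂)` over `k = ℚ(ζ₃)` is a structure of type `(ℚ(ζ₁₂), Φ)` for some CM type `Φ` of `ℚ(ζ₁₂)`**
— Shimura's type inflation `(ℚ(√-3); {ψ}) ↦ (ℚ(ζ₁₂); Φ)` realised on `E′ × E′` («`ℂⁿ/D(𝔪)` is … isomorphic to the
direct product of `h` copies of `ℂ^m/Δ`», `h = 2`), on the algebraic carrier over a number field; `dim = 2`,
`[K : ℚ] = 4`, `K = ℚ(ζ₁₂) ≠ k = ℚ(ζ₃)`. [cite: Shimura1998, §6.2 Theorem 3 (pp. 41–43) and §19.7] -/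
theorem exists_isCMTypeRealisationOver_twelve :
    ∃ Φ : CMType K₁₂, IsCMTypeRealisationOver Φ (AbelianVariety.prod E′ E′) iota₁₂ :=
  exists_isCMTypeRealisationOver_iotaOfCyclotomic _ _ _ two_mul_dim_prod_eq_totient_twelve

/-- **`(E′ × E′) ⊗_k ℂ` is not simple** («Moreover, if `F` does not coincide with `K`, `A` is not simple»): it
realises a non-primitive CM type of `ℚ(ζ₁₂)` (`GaussianCMSquare.not_isPrimitive_twelve`; Shimura §8.2 Prop. 26
through the tree's `not_isSimple_of_isCMTypeRealisation_of_not_isPrimitive`).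
[cite: Shimura1998, §6.2 Theorem 3 (last clause) and §8.2 Prop. 26] -/
theorem not_isSimple_baseChange : ¬ ((AbelianVariety.prod E′ E′).baseChange ℂ).IsSimple := by
  obtain ⟨Φ, hΦ⟩ := exists_isCMTypeRealisationOver_twelve
  obtain ⟨φ₀⟩ := (inferInstance : Nonempty (K₁₂ →+* ℂ))
  exact not_isSimple_baseChange_of_not_isPrimitive _ hΦ φ₀ (GaussianCMSquare.not_isPrimitive_twelve Φ φ₀)

/-! ### The type of `(E′ × E′, ι₁₂)` is the type INDUCED from the type of `(E′, ι₀)` -/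

/-- `ζ₁₂⁴` is a primitive cube root of unity. [folklore] -/
private theorem isPrimitiveRoot_zeta_twelve_pow_four : IsPrimitiveRoot ((zeta 12 ℚ K₁₂) ^ 4) 3 :=
  (zeta_spec 12 ℚ K₁₂).pow (by norm_num) (show 12 = 4 * 3 by norm_num)

/-- **The embedding `j : ℚ(ζ₃) → ℚ(ζ₁₂)`, `ζ₃ ↦ ζ₁₂⁴`** (`K = ℚ(√-3) ⊂ F = ℚ(ζ₁₂) = K(i)`: the inclusion along
which Shimura's type `{φᵢ}` of `F` is induced from `{ψⱼ}`; Mathlib's `PowerBasis.lift`, legitimate because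
`ζ₁₂⁴` is a root of `Φ₃ = minpoly ζ₃`). [cite: Shimura1998, §6.2 Theorem 3 (`F ⊃ K`)] -/
def jEmb₃ : K₃ →ₐ[ℚ] K₁₂ :=
  ((zeta_spec 3 ℚ K₃).powerBasis ℚ).lift ((zeta 12 ℚ K₁₂) ^ 4) (by
    rw [IsPrimitiveRoot.powerBasis_gen, ← cyclotomic_eq_minpoly_rat (zeta_spec 3 ℚ K₃) (by norm_num),
      cyclotomic_eq_minpoly_rat isPrimitiveRoot_zeta_twelve_pow_four (by norm_num)]
    exact minpoly.aeval ℚ _)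

/-- `j(ζ₃) = ζ₁₂⁴`. [cite: Shimura1998, §6.2 Theorem 3 (`F ⊃ K`)] -/
theorem jEmb₃_zeta : jEmb₃ (zeta 3 ℚ K₃) = (zeta 12 ℚ K₁₂) ^ 4 := by
  have h : jEmb₃ ((zeta_spec 3 ℚ K₃).powerBasis ℚ).gen = (zeta 12 ℚ K₁₂) ^ 4 := PowerBasis.lift_gen _ _ _
  rwa [IsPrimitiveRoot.powerBasis_gen] at h

/-- `ι₁₂(ζ₁₂⁴) = (rot₁₂^ω)⁴ = [ω] ⊕ [ω]`. [cite: Shimura1998, §6.2 Theorem 3, proof] -/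
theorem iota₁₂_toInteger_zeta_pow_four :
    iota₁₂ ((zeta_spec 12 ℚ K₁₂).toInteger ^ 4) = diagEnd E′ mulω := by
  rw [map_pow, iota₁₂_toInteger_zeta]
  exact rot12OfOmega_pow_four E′ (J0.mulOmega_comp_mulOmega_add EisensteinCMCurve.zeta_sq_add_zeta_add_one)

/-- **THE TYPE OF `(E′ × E′, ι₁₂)` IS THE INDUCED TYPE** (Shimura 1998 §6.2 Theorem 3: «`(A, ι)` is of type
`(F; {φᵢ})`», with «the `φᵢ` … all the isomorphisms of `F` into `ℂ` inducing the `ψⱼ` on `K`», `F = ℚ(ζ₁₂) ⊃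
K = ℚ(√-3)`): if `(E′, ι₀)` is of type `(ℚ(ζ₃), Φ₁)` over `k = ℚ(ζ₃)` and `(E′ × E′, ι₁₂)` is of type `(ℚ(ζ₁₂), Φ)`
over `k`, then `Φ = Φ₁^{ℚ(ζ₁₂)}` along `j : ζ₃ ↦ ζ₁₂⁴` — by the general
`CMSquare.cmType_eq_inducedCMType_of_finrank_eq_two` (the `K`-structure extends the diagonal `ℚ(√-3)`-structure:
`ι₁₂(ζ₁₂⁴) = [ω] ⊕ [ω]`). [cite: Shimura1998, §6.2 Theorem 3 with proof (pp. 41–43)] [cite: Streng2010, Ch. I Def. 3.2] -/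
theorem cmType_eq_inducedCMType {Φ₁ : CMType K₃} {Φ : CMType K₁₂}
    (h₁ : IsCMTypeRealisationOver Φ₁ E′ EisensteinCMCurve.iota₀)
    (h : IsCMTypeRealisationOver Φ (AbelianVariety.prod E′ E′) iota₁₂) :
    Φ = inducedCMType (jEmb₃ : K₃ →ₐ[ℚ] K₁₂).toRingHom Φ₁ :=
  cmType_eq_inducedCMType_of_finrank_eq_two E′ EisensteinCMCurve.finrank_eq_two
    (ringHom_ext_of_apply_eq_of_isCyclotomicExtension (zeta_spec 3 ℚ K₃)) _
    (a := (zeta_spec 12 ℚ K₁₂).toInteger ^ 4)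
    (by rw [AlgHom.toRingHom_eq_coe, RingHom.coe_coe]; exact jEmb₃_zeta)
    (by rw [iota₁₂_toInteger_zeta_pow_four, EisensteinCMCurve.iota₀_toInteger_zeta]) h₁ h

/-- **The structures `(E′, ι₀)` and `(E′ × E′, ι₁₂)` over `ℚ(ζ₃)` realise a type `Φ₁` of `ℚ(ζ₃)` and the type
`Φ₁^{ℚ(ζ₁₂)}` INDUCED from it** — Shimura's type inflation `(K; {ψⱼ}) ↦ (F; {φᵢ})` on `A^h` (`h = 2`) for
`F = ℚ(ζ₁₂) ⊃ K = ℚ(√-3)`, on the algebraic carrier over a number field.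
[cite: Shimura1998, §6.2 Theorem 3 (pp. 41–43)] [cite: Streng2010, Ch. I Def. 3.2] -/
theorem exists_isCMTypeRealisationOver_inducedCMType :
    ∃ Φ₁ : CMType K₃, IsCMTypeRealisationOver Φ₁ E′ EisensteinCMCurve.iota₀ ∧
      IsCMTypeRealisationOver (inducedCMType (jEmb₃ : K₃ →ₐ[ℚ] K₁₂).toRingHom Φ₁)
        (AbelianVariety.prod E′ E′) iota₁₂ := by
  obtain ⟨Φ₁, h₁⟩ := EisensteinCMCurve.exists_isCMTypeRealisationOver_iota₀
  obtain ⟨Φ, h⟩ := exists_isCMTypeRealisationOver_twelve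
  refine ⟨Φ₁, h₁, ?_⟩
  rw [← cmType_eq_inducedCMType h₁ h]; exact h

end EisensteinCMSquare

/-! ## §3 Headline: a two-dimensional structure of type `(ℚ(ζ₁₂), Φ)` over `ℚ(ζ₃)` -/

/-- **A structure `(A₀, ι₀)` of type `(ℚ(ζ₁₂), Φ)` over the number field `ℚ(ζ₃)` with `dim A₀ = 2` and `A₀ ⊗ ℂ`
NOT simple EXISTS on the tree's carrier**: `A₀ = E′ × E′` for the Eisenstein curve `E′ : y² + y = x³`,
`ι₀ : ℤ[ζ₁₂] → End_k(E′ × E′)`, `ζ₁₂ ↦ ((P, Q) ↦ (−[ω]Q, [ω]P))` — Shimura's type inflation §6.2 Thm 3 with `h = 2`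
from `K = ℚ(√-3)` to `F = ℚ(ζ₁₂)`, with its last clause; the companion over the OTHER imaginary quadratic subfield
of `ℚ(ζ₁₂)` of `GaussianCMSquare.exists_isCMTypeRealisationOver_twelve` (`E × E` over `ℚ(i)`).
[cite: Shimura1998, §6.2 Theorem 3 and §19.7] [cite: SilvermanAEC2009, App. C §11 Example 11.3.1] -/
theorem exists_isCMTypeRealisationOver_dim_two_of_sqrt_neg_three :
    ∃ (_ : Algebra (CyclotomicField 3 ℚ) ℂ) (Φ : CMType (CyclotomicField 12 ℚ))
      (A₀ : AbelianVariety (CyclotomicField 3 ℚ)) (ι₀ : 𝓞 (CyclotomicField 12 ℚ) →+* End A₀),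
      Module.finrank ℚ (CyclotomicField 3 ℚ) = 2 ∧ Module.finrank ℚ (CyclotomicField 12 ℚ) = 4 ∧ A₀.dim = 2 ∧
        IsCMTypeRealisationOver Φ A₀ ι₀ ∧ ¬ (A₀.baseChange ℂ).IsSimple := by
  letI : Algebra (CyclotomicField 3 ℚ) ℂ := EisensteinCMCurve.algebraComplex
  letI : Fact (IsUnit (3 : CyclotomicField 3 ℚ)) := ⟨isUnit_iff_ne_zero.mpr three_ne_zero⟩
  haveI : IsCyclotomicExtension {3} ℚ (CyclotomicField 3 ℚ) := CyclotomicField.isCyclotomicExtension 3 ℚ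
  haveI : IsCyclotomicExtension {12} ℚ (CyclotomicField 12 ℚ) := CyclotomicField.isCyclotomicExtension 12 ℚ
  obtain ⟨Φ, hΦ⟩ := EisensteinCMSquare.exists_isCMTypeRealisationOver_twelve
  exact ⟨EisensteinCMCurve.algebraComplex, Φ,
    AbelianVariety.prod (J0.abelianVariety (CyclotomicField 3 ℚ)) (J0.abelianVariety (CyclotomicField 3 ℚ)),
    EisensteinCMSquare.iota₁₂, EisensteinCMCurve.finrank_eq_two, EisensteinCMSquare.finrank_twelve,
    EisensteinCMSquare.dim_prod, hΦ, EisensteinCMSquare.not_isSimple_baseChange⟩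

/-! ## §4 Every CM type of `ℚ(√-3)` (resp. `ℚ(i)`) inflates to a structure on `E′ × E′` (resp. `E × E`) -/

namespace EisensteinCMSquare

open CMSquare

local notation "K₃" => CyclotomicField 3 ℚ
local notation "K₁₂" => CyclotomicField 12 ℚ

/-- `ℚ(ζ₃)/ℚ` is `{3}`-cyclotomic (LOCAL instance). [folklore] -/
private theorem isCyclotomicExtension_three_b : IsCyclotomicExtension {3} ℚ K₃ :=
  CyclotomicField.isCyclotomicExtension 3 ℚ

/-- `ℚ(ζ₁₂)/ℚ` is `{12}`-cyclotomic (LOCAL instance). [folklore] -/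
private theorem isCyclotomicExtension_twelve_b : IsCyclotomicExtension {12} ℚ K₁₂ :=
  CyclotomicField.isCyclotomicExtension 12 ℚ

attribute [local instance] isCyclotomicExtension_three_b isCyclotomicExtension_twelve_b
attribute [local instance] EisensteinCMCurve.algebraComplex

/-- `3` is a unit of `ℚ(ζ₃)` (LOCAL instance). [folklore] -/
private theorem fact_isUnit_three_b : Fact (IsUnit (3 : K₃)) := ⟨isUnit_iff_ne_zero.mpr three_ne_zero⟩

attribute [local instance] fact_isUnit_three_b

local notation "E′" => J0.abelianVariety (CyclotomicField 3 ℚ)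

/-- For ANY `ℤ[ζ₃]`-structure `ι₁` on `E′`, `u = ι₁(ζ₃)` satisfies `u ≫ u + u + 𝟙 = 0` (`ζ₃² + ζ₃ + 1 = 0` in `ℤ[ζ₃]`).
[cite: SilvermanAEC2009, App. C §11 Example 11.3.1] -/
theorem comp_add_of_ringHom (ι₁ : 𝓞 K₃ →+* End E′) :
    (show E′ ⟶ E′ from ι₁ (zeta_spec 3 ℚ K₃).toInteger) ≫ (show E′ ⟶ E′ from ι₁ (zeta_spec 3 ℚ K₃).toInteger) +
      (show E′ ⟶ E′ from ι₁ (zeta_spec 3 ℚ K₃).toInteger) + 𝟙 E′ = 0 := by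
  have hζ : (zeta_spec 3 ℚ K₃).toInteger ^ 2 + (zeta_spec 3 ℚ K₃).toInteger + 1 = 0 := by
    apply RingOfIntegers.coe_injective
    push_cast
    exact EisensteinCMCurve.zeta_sq_add_zeta_add_one
  have h := congrArg ι₁ hζ
  rw [map_add, map_add, map_pow, map_one, map_zero, sq, End.mul_def] at h
  exact h

/-- **Every structure `(E′, ι₁)` of type `(ℚ(ζ₃), Ψ)` over `ℚ(ζ₃)` inflates to a structure `(E′ × E′, ι)` of the
INDUCED type `(ℚ(ζ₁₂), Ψ^{ℚ(ζ₁₂)})`** (`ζ₁₂ ↦ rot₄ ≫ (ι₁(ζ₃) ⊕ ι₁(ζ₃))`; Shimura §6.2 Thm 3 for `(K; {ψⱼ}) = (ℚ(√-3), Ψ)`,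
`F = ℚ(ζ₁₂)`, `h = 2`, existence AND identification of the type).
[cite: Shimura1998, §6.2 Theorem 3 (pp. 41–43) and §19.7] -/
theorem exists_isCMTypeRealisationOver_inducedCMType_of {Ψ : CMType K₃} {ι₁ : 𝓞 K₃ →+* End E′}
    (h₁ : IsCMTypeRealisationOver Ψ E′ ι₁) :
    ∃ ι : 𝓞 K₁₂ →+* End (AbelianVariety.prod E′ E′),
      IsCMTypeRealisationOver (inducedCMType (jEmb₃ : K₃ →ₐ[ℚ] K₁₂).toRingHom Ψ) (AbelianVariety.prod E′ E′) ι := by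
  have hu := comp_add_of_ringHom ι₁
  have haev := aeval_rot12OfOmega_cyclotomic E′ hu
  obtain ⟨Φ, hΦ⟩ := exists_isCMTypeRealisationOver_iotaOfCyclotomic (zeta_spec 12 ℚ K₁₂)
    (AbelianVariety.prod E′ E′) haev two_mul_dim_prod_eq_totient_twelve
  refine ⟨iotaOfCyclotomic (zeta_spec 12 ℚ K₁₂) (AbelianVariety.prod E′ E′) haev, ?_⟩
  have hιa : iotaOfCyclotomic (zeta_spec 12 ℚ K₁₂) (AbelianVariety.prod E′ E′) haev
      ((zeta_spec 12 ℚ K₁₂).toInteger ^ 4) = diagEnd E′ (ι₁ (zeta_spec 3 ℚ K₃).toInteger) := by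
    rw [map_pow, iotaOfCyclotomic_toInteger]
    exact rot12OfOmega_pow_four E′ hu
  have heq := cmType_eq_inducedCMType_of_finrank_eq_two E′ EisensteinCMCurve.finrank_eq_two
    (ringHom_ext_of_apply_eq_of_isCyclotomicExtension (zeta_spec 3 ℚ K₃))
    (jEmb₃ : K₃ →ₐ[ℚ] K₁₂).toRingHom (a := (zeta_spec 12 ℚ K₁₂).toInteger ^ 4)
    (by rw [AlgHom.toRingHom_eq_coe, RingHom.coe_coe]; exact jEmb₃_zeta) hιa h₁ hΦ
  rw [← heq]
  exact hΦ

/-- **For EVERY CM type `Ψ` of `ℚ(ζ₃)`, the induced type `Ψ^{ℚ(ζ₁₂)}` is realised over `ℚ(ζ₃)` on `E′ × E′`**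
(both types of `ℚ(√-3)` are realised on `E′`, `EisensteinCMCurve.exists_isCMTypeRealisationOver_of_cmType`).
[cite: Shimura1998, §6.2 Theorem 3 and §8.4 Examples (1), (2)(A)] -/
theorem forall_cmType_exists_isCMTypeRealisationOver_inducedCMType (Ψ : CMType K₃) :
    ∃ ι : 𝓞 K₁₂ →+* End (AbelianVariety.prod E′ E′),
      IsCMTypeRealisationOver (inducedCMType (jEmb₃ : K₃ →ₐ[ℚ] K₁₂).toRingHom Ψ) (AbelianVariety.prod E′ E′) ι := by
  obtain ⟨ι₁, h₁⟩ := EisensteinCMCurve.exists_isCMTypeRealisationOver_of_cmType Ψ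
  exact exists_isCMTypeRealisationOver_inducedCMType_of h₁

end EisensteinCMSquare

namespace GaussianCMSquare

open CMSquare

local notation "K₄" => CyclotomicField 4 ℚ
local notation "K₁₂" => CyclotomicField 12 ℚ

/-- `ℚ(ζ₄)/ℚ` is `{4}`-cyclotomic (LOCAL instance). [folklore] -/
private theorem isCyclotomicExtension_four_b : IsCyclotomicExtension {4} ℚ K₄ :=
  CyclotomicField.isCyclotomicExtension 4 ℚ

/-- `ℚ(ζ₁₂)/ℚ` is `{12}`-cyclotomic (LOCAL instance). [folklore] -/
private theorem isCyclotomicExtension_twelve_c : IsCyclotomicExtension {12} ℚ K₁₂ :=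
  CyclotomicField.isCyclotomicExtension 12 ℚ

attribute [local instance] isCyclotomicExtension_four_b isCyclotomicExtension_twelve_c
attribute [local instance] GaussianCMCurve.algebraComplex

/-- `2` is a unit of `ℚ(ζ₄)` (LOCAL instance). [folklore] -/
private theorem fact_isUnit_two_b : Fact (IsUnit (2 : K₄)) := ⟨isUnit_iff_ne_zero.mpr two_ne_zero⟩

attribute [local instance] fact_isUnit_two_b

local notation "E" => J1728.abelianVariety (CyclotomicField 4 ℚ)

/-- For ANY `ℤ[i]`-structure `ι₁` on `E`, `u = ι₁(ζ₄)` satisfies `u ≫ u = −𝟙` (`ζ₄² = −1` in `ℤ[ζ₄]`).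
[cite: SilvermanAEC2009, III.4 Example 4.4] -/
theorem comp_self_of_ringHom (ι₁ : 𝓞 K₄ →+* End E) :
    (show E ⟶ E from ι₁ (zeta_spec 4 ℚ K₄).toInteger) ≫ (show E ⟶ E from ι₁ (zeta_spec 4 ℚ K₄).toInteger) =
      -𝟙 E := by
  have hζ : (zeta_spec 4 ℚ K₄).toInteger ^ 2 = -1 := by
    apply RingOfIntegers.coe_injective
    push_cast
    exact GaussianCMCurve.zeta_sq
  have h := congrArg ι₁ hζ
  rw [map_pow, map_neg, map_one, sq, End.mul_def] at h
  exact h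

/-- **Every structure `(E, ι₁)` of type `(ℚ(ζ₄), Ψ)` over `ℚ(ζ₄)` inflates to a structure `(E × E, ι)` of the INDUCED
type `(ℚ(ζ₁₂), Ψ^{ℚ(ζ₁₂)})`** (`ζ₁₂ ↦ rot₃ ≫ (ι₁(ζ₄) ⊕ ι₁(ζ₄))`, along `j′ : ζ₄ ↦ ζ₁₂⁹`; Shimura §6.2 Thm 3 for
`(K; {ψⱼ}) = (ℚ(i), Ψ)`, `F = ℚ(ζ₁₂)`, `h = 2`). [cite: Shimura1998, §6.2 Theorem 3 (pp. 41–43) and §19.7] -/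
theorem exists_isCMTypeRealisationOver_inducedCMType_twelve_of {Ψ : CMType K₄} {ι₁ : 𝓞 K₄ →+* End E}
    (h₁ : IsCMTypeRealisationOver Ψ E ι₁) :
    ∃ ι : 𝓞 K₁₂ →+* End (AbelianVariety.prod E E),
      IsCMTypeRealisationOver (inducedCMType (jEmb₁₂ : K₄ →ₐ[ℚ] K₁₂).toRingHom Ψ) (AbelianVariety.prod E E) ι := by
  have hu := comp_self_of_ringHom ι₁
  have haev := aeval_rot12Of_cyclotomic E hu
  obtain ⟨Φ, hΦ⟩ := exists_isCMTypeRealisationOver_iotaOfCyclotomic (zeta_spec 12 ℚ K₁₂)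
    (AbelianVariety.prod E E) haev two_mul_dim_prod_eq_totient_twelve
  refine ⟨iotaOfCyclotomic (zeta_spec 12 ℚ K₁₂) (AbelianVariety.prod E E) haev, ?_⟩
  have hιa : iotaOfCyclotomic (zeta_spec 12 ℚ K₁₂) (AbelianVariety.prod E E) haev
      ((zeta_spec 12 ℚ K₁₂).toInteger ^ 9) = diagEnd E (ι₁ (zeta_spec 4 ℚ K₄).toInteger) := by
    rw [map_pow, iotaOfCyclotomic_toInteger]
    exact rot12Of_pow_nine E hu
  have heq := cmType_eq_inducedCMType_of_finrank_eq_two E GaussianCMCurve.finrank_eq_two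
    (ringHom_ext_of_apply_eq_of_isCyclotomicExtension (zeta_spec 4 ℚ K₄))
    (jEmb₁₂ : K₄ →ₐ[ℚ] K₁₂).toRingHom (a := (zeta_spec 12 ℚ K₁₂).toInteger ^ 9)
    (by rw [AlgHom.toRingHom_eq_coe, RingHom.coe_coe]; exact jEmb₁₂_zeta) hιa h₁ hΦ
  rw [← heq]
  exact hΦ

/-- **For EVERY CM type `Ψ` of `ℚ(ζ₄)`, the induced type `Ψ^{ℚ(ζ₁₂)}` is realised over `ℚ(ζ₄)` on `E × E`**
(both types of `ℚ(i)` are realised on `E`, `GaussianCMCurve.exists_isCMTypeRealisationOver_of_cmType`).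
[cite: Shimura1998, §6.2 Theorem 3 and §8.4 Examples (1), (2)(A)] -/
theorem forall_cmType_exists_isCMTypeRealisationOver_inducedCMType_twelve (Ψ : CMType K₄) :
    ∃ ι : 𝓞 K₁₂ →+* End (AbelianVariety.prod E E),
      IsCMTypeRealisationOver (inducedCMType (jEmb₁₂ : K₄ →ₐ[ℚ] K₁₂).toRingHom Ψ) (AbelianVariety.prod E E) ι := by
  obtain ⟨ι₁, h₁⟩ := GaussianCMCurve.exists_isCMTypeRealisationOver_of_cmType Ψ
  exact exists_isCMTypeRealisationOver_inducedCMType_twelve_of h₁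

end GaussianCMSquare

/-! ## §5 Every CM type of `ℚ(ζ₁₂)` is induced from `ℚ(i)` or from `ℚ(√-3)`, hence realised on a square -/

namespace CyclotomicTwelve

local notation "K₃" => CyclotomicField 3 ℚ
local notation "K₄" => CyclotomicField 4 ℚ
local notation "K₁₂" => CyclotomicField 12 ℚ

/-- `ℚ(ζ₃)/ℚ` is `{3}`-cyclotomic (LOCAL instance). [folklore] -/
private theorem isCyclotomicExtension₃ : IsCyclotomicExtension {3} ℚ K₃ := CyclotomicField.isCyclotomicExtension 3 ℚ
/-- `ℚ(ζ₄)/ℚ` is `{4}`-cyclotomic (LOCAL instance). [folklore] -/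
private theorem isCyclotomicExtension₄ : IsCyclotomicExtension {4} ℚ K₄ := CyclotomicField.isCyclotomicExtension 4 ℚ
/-- `ℚ(ζ₁₂)/ℚ` is `{12}`-cyclotomic (LOCAL instance). [folklore] -/
private theorem isCyclotomicExtension₁₂ : IsCyclotomicExtension {12} ℚ K₁₂ :=
  CyclotomicField.isCyclotomicExtension 12 ℚ

attribute [local instance] isCyclotomicExtension₃ isCyclotomicExtension₄ isCyclotomicExtension₁₂

/-- **Two embeddings `σ, σ′ : ℚ(ζ₁₂) → ℂ` with `σ′ ∉ {σ, σ̄}` agree at `ζ₁₂⁹` (a generator of `ℚ(i)`) or at `ζ₁₂⁴`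
(a generator of `ℚ(√-3)`)**: `σ′(ζ₁₂) = σ(ζ₁₂)^a` with `a ∈ {5, 7}` (`a = 1`: `σ′ = σ`; `a = 11`: `σ′ = σ̄`), and
`a = 5` fixes `ζ₁₂⁹` (`45 ≡ 9 mod 12`), `a = 7` fixes `ζ₁₂⁴` (`28 ≡ 4`) — the two elements of
`Gal(ℚ(ζ₁₂)/ℚ) ≅ (ℤ/12)^×` other than `1` and complex conjugation fix `ℚ(i)` and `ℚ(√-3)` respectively.
[cite: Shimura1998, §8.4 Example (2)(A)] -/
theorem apply_zeta_pow_nine_eq_or_apply_zeta_pow_four_eq (σ σ' : K₁₂ →+* ℂ) (hne : σ' ≠ σ)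
    (hnc : σ' ≠ NumberField.ComplexEmbedding.conjugate σ) :
    σ ((zeta 12 ℚ K₁₂) ^ 9) = σ' ((zeta 12 ℚ K₁₂) ^ 9) ∨ σ ((zeta 12 ℚ K₁₂) ^ 4) = σ' ((zeta 12 ℚ K₁₂) ^ 4) := by
  have hx : IsPrimitiveRoot (σ (zeta 12 ℚ K₁₂)) 12 := (zeta_spec 12 ℚ K₁₂).map_of_injective σ.injective
  have hy : IsPrimitiveRoot (σ' (zeta 12 ℚ K₁₂)) 12 := (zeta_spec 12 ℚ K₁₂).map_of_injective σ'.injective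
  obtain ⟨i, hi, hxy⟩ := hx.eq_pow_of_pow_eq_one hy.pow_eq_one
  have hcop : i.Coprime 12 := (hx.pow_iff_coprime (by norm_num) i).1 (hxy ▸ hy)
  -- `σ′` is determined by `σ′(ζ₁₂) = σ(ζ₁₂)^i`
  have key : ∀ m : ℕ, σ' ((zeta 12 ℚ K₁₂) ^ m) = σ (zeta 12 ℚ K₁₂) ^ (i * m) := fun m => by
    rw [map_pow, ← hxy, ← pow_mul]
  have h12 : σ (zeta 12 ℚ K₁₂) ^ 12 = 1 := hx.pow_eq_one
  interval_cases i
  all_goals try (exfalso; revert hcop; decide)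
  · -- `i = 1`: `σ′ = σ`
    exfalso
    apply hne
    refine CMSquare.ringHom_ext_of_apply_eq_of_isCyclotomicExtension (zeta_spec 12 ℚ K₁₂) _ _ ?_
    change σ' (zeta 12 ℚ K₁₂) = σ (zeta 12 ℚ K₁₂)
    rw [← hxy, pow_one]
  · -- `i = 5`: agree on `ζ₁₂⁹`
    left
    rw [key, map_pow, show (5 * 9 : ℕ) = 12 * 3 + 9 by norm_num, pow_add, pow_mul, h12, one_pow, one_mul]
  · -- `i = 7`: agree on `ζ₁₂⁴`
    right
    rw [key, map_pow, show (7 * 4 : ℕ) = 12 * 2 + 4 by norm_num, pow_add, pow_mul, h12, one_pow, one_mul]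
  · -- `i = 11`: `σ′ = σ̄`
    exfalso
    apply hnc
    refine CMSquare.ringHom_ext_of_apply_eq_of_isCyclotomicExtension (zeta_spec 12 ℚ K₁₂) _ _ ?_
    change σ' (zeta 12 ℚ K₁₂) = NumberField.ComplexEmbedding.conjugate σ (zeta 12 ℚ K₁₂)
    rw [NumberField.ComplexEmbedding.conjugate_coe_eq, ← hxy,
      ← Complex.inv_eq_conj (Complex.norm_eq_one_of_pow_eq_one h12 (by norm_num))]
    have h : σ (zeta 12 ℚ K₁₂) ^ 11 * σ (zeta 12 ℚ K₁₂) = 1 := by rw [← pow_succ, h12]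
    exact eq_inv_of_mul_eq_one_left h

/-- **Every CM type of `ℚ(ζ₁₂)` is induced from `ℚ(i)` (along `ζ₄ ↦ ζ₁₂⁹`) or from `ℚ(√-3)` (along
`ζ₃ ↦ ζ₁₂⁴`)** — Shimura §8.4 Example (2)(A) for the biquadratic CM field `ℚ(ζ₁₂) = ℚ(i, √-3)`: «`K₀((ξ))` is
not primitive» and the type comes from one of the two imaginary quadratic subfields; here with the two
inclusions named. [cite: Shimura1998, §8.4 Example (2)(A)] -/
theorem exists_eq_inducedCMType_or (Φ : CMType K₁₂) :
    (∃ Ψ : CMType K₄, Φ = inducedCMType (GaussianCMSquare.jEmb₁₂ : K₄ →ₐ[ℚ] K₁₂).toRingHom Ψ) ∨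
      (∃ Ψ : CMType K₃, Φ = inducedCMType (EisensteinCMSquare.jEmb₃ : K₃ →ₐ[ℚ] K₁₂).toRingHom Ψ) := by
  have h4 : Module.finrank ℚ K₁₂ = 4 := by
    rw [IsCyclotomicExtension.finrank K₁₂ (cyclotomic.irreducible_rat (n := 12) (by norm_num))]; decide
  obtain ⟨σ, σ', hne, hΦ⟩ := Set.ncard_eq_two.1 (ncard_eq_two_of_finrank_eq_four h4 Φ)
  have hσ : σ ∈ Φ.1 := by rw [hΦ]; exact Set.mem_insert σ _
  have hσ' : σ' ∈ Φ.1 := by rw [hΦ]; exact Set.mem_insert_of_mem σ rfl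
  have hnc : σ' ≠ NumberField.ComplexEmbedding.conjugate σ := fun h => ((Φ.2 σ).1 hσ) (h ▸ hσ')
  rcases apply_zeta_pow_nine_eq_or_apply_zeta_pow_four_eq σ σ' hne.symm hnc with h9 | h4'
  · -- induced from `ℚ(i)`: `Φ = {σ, σ′}` and both restrict to `ψ = σ ∘ j′`
    left
    set j : K₄ →+* K₁₂ := (GaussianCMSquare.jEmb₁₂ : K₄ →ₐ[ℚ] K₁₂).toRingHom with hj
    have hjζ : j ((zeta_spec 4 ℚ K₄).toInteger : K₄) = (zeta 12 ℚ K₁₂) ^ 9 := by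
      rw [hj, AlgHom.toRingHom_eq_coe, RingHom.coe_coe]; exact GaussianCMSquare.jEmb₁₂_zeta
    have hrestr : σ'.comp j = σ.comp j :=
      CMSquare.ringHom_ext_of_apply_eq_of_isCyclotomicExtension (zeta_spec 4 ℚ K₄) _ _
        (by rw [RingHom.comp_apply, RingHom.comp_apply, hjζ, h9])
    refine ⟨CMTypeCount.single GaussianCMCurve.finrank_eq_two (σ.comp j), CMType.eq_of_subset fun τ hτ => ?_⟩
    rw [mem_inducedCMType_iff, CMTypeCount.single_val, Set.mem_singleton_iff]
    rw [hΦ] at hτ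
    rcases hτ with rfl | hτ
    · rfl
    · rw [Set.mem_singleton_iff.1 hτ, hrestr]
  · -- induced from `ℚ(√-3)`
    right
    set j : K₃ →+* K₁₂ := (EisensteinCMSquare.jEmb₃ : K₃ →ₐ[ℚ] K₁₂).toRingHom with hj
    have hjζ : j ((zeta_spec 3 ℚ K₃).toInteger : K₃) = (zeta 12 ℚ K₁₂) ^ 4 := by
      rw [hj, AlgHom.toRingHom_eq_coe, RingHom.coe_coe]; exact EisensteinCMSquare.jEmb₃_zeta
    have hrestr : σ'.comp j = σ.comp j :=
      CMSquare.ringHom_ext_of_apply_eq_of_isCyclotomicExtension (zeta_spec 3 ℚ K₃) _ _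
        (by rw [RingHom.comp_apply, RingHom.comp_apply, hjζ, h4'])
    refine ⟨CMTypeCount.single EisensteinCMCurve.finrank_eq_two (σ.comp j), CMType.eq_of_subset fun τ hτ => ?_⟩
    rw [mem_inducedCMType_iff, CMTypeCount.single_val, Set.mem_singleton_iff]
    rw [hΦ] at hτ
    rcases hτ with rfl | hτ
    · rfl
    · rw [Set.mem_singleton_iff.1 hτ, hrestr]

end CyclotomicTwelve

/-- **EVERY CM type of `ℚ(ζ₁₂)` is the type of the square of a CM elliptic curve over a quadratic field** — Shimura
1998 §6.2 Theorem 3 (`h = 2`) for `F = ℚ(ζ₁₂) = ℚ(i, √-3)` in full: all four CM types of the biquadratic CM field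
`ℚ(ζ₁₂)` (none primitive, §8.4 Example (2)(A)) are realised on the tree's carrier `IsCMTypeRealisationOver` over a
number field — the two induced from `ℚ(i)` on `E × E` over `ℚ(ζ₄)` (`E : y² = x³ + x`), the two induced from
`ℚ(√-3)` on `E′ × E′` over `ℚ(ζ₃)` (`E′ : y² + y = x³`). [cite: Shimura1998, §6.2 Theorem 3, §8.4 Example (2)(A), §19.7]
[cite: SilvermanAEC2009, III.10.1 and App. C §11 Example 11.3.1] -/
theorem forall_cmType_twelve_exists_isCMTypeRealisationOver :
    letI : Algebra (CyclotomicField 4 ℚ) ℂ := GaussianCMCurve.algebraComplex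
    letI : Algebra (CyclotomicField 3 ℚ) ℂ := EisensteinCMCurve.algebraComplex
    letI : Fact (IsUnit (2 : CyclotomicField 4 ℚ)) := ⟨isUnit_iff_ne_zero.mpr two_ne_zero⟩
    letI : Fact (IsUnit (3 : CyclotomicField 3 ℚ)) := ⟨isUnit_iff_ne_zero.mpr three_ne_zero⟩
    ∀ Φ : CMType (CyclotomicField 12 ℚ),
      (∃ ι : 𝓞 (CyclotomicField 12 ℚ) →+*
          End (AbelianVariety.prod (J1728.abelianVariety (CyclotomicField 4 ℚ))
            (J1728.abelianVariety (CyclotomicField 4 ℚ))),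
        IsCMTypeRealisationOver Φ (AbelianVariety.prod (J1728.abelianVariety (CyclotomicField 4 ℚ))
          (J1728.abelianVariety (CyclotomicField 4 ℚ))) ι) ∨
      (∃ ι : 𝓞 (CyclotomicField 12 ℚ) →+*
          End (AbelianVariety.prod (J0.abelianVariety (CyclotomicField 3 ℚ))
            (J0.abelianVariety (CyclotomicField 3 ℚ))),
        IsCMTypeRealisationOver Φ (AbelianVariety.prod (J0.abelianVariety (CyclotomicField 3 ℚ))
          (J0.abelianVariety (CyclotomicField 3 ℚ))) ι) := by
  letI : Algebra (CyclotomicField 4 ℚ) ℂ := GaussianCMCurve.algebraComplex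
  letI : Algebra (CyclotomicField 3 ℚ) ℂ := EisensteinCMCurve.algebraComplex
  letI : Fact (IsUnit (2 : CyclotomicField 4 ℚ)) := ⟨isUnit_iff_ne_zero.mpr two_ne_zero⟩
  letI : Fact (IsUnit (3 : CyclotomicField 3 ℚ)) := ⟨isUnit_iff_ne_zero.mpr three_ne_zero⟩
  haveI : IsCyclotomicExtension {3} ℚ (CyclotomicField 3 ℚ) := CyclotomicField.isCyclotomicExtension 3 ℚ
  haveI : IsCyclotomicExtension {4} ℚ (CyclotomicField 4 ℚ) := CyclotomicField.isCyclotomicExtension 4 ℚ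
  haveI : IsCyclotomicExtension {12} ℚ (CyclotomicField 12 ℚ) := CyclotomicField.isCyclotomicExtension 12 ℚ
  intro Φ
  rcases CyclotomicTwelve.exists_eq_inducedCMType_or Φ with ⟨Ψ, rfl⟩ | ⟨Ψ, rfl⟩
  · exact Or.inl (GaussianCMSquare.forall_cmType_exists_isCMTypeRealisationOver_inducedCMType_twelve Ψ)
  · exact Or.inr (EisensteinCMSquare.forall_cmType_exists_isCMTypeRealisationOver_inducedCMType Ψ)

/-! ## §6 The `ℚ(ζ₈)` companion: every CM type of `ℚ(i)` inflates along `ζ₄ ↦ ζ₈²` to a structure on `E × E` -/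

namespace GaussianCMSquare

open CMSquare

local notation "K₄" => CyclotomicField 4 ℚ
local notation "K₈" => CyclotomicField 8 ℚ

/-- `ℚ(ζ₄)/ℚ` is `{4}`-cyclotomic (LOCAL instance). [folklore] -/
private theorem isCyclotomicExtension_four_c : IsCyclotomicExtension {4} ℚ K₄ :=
  CyclotomicField.isCyclotomicExtension 4 ℚ

/-- `ℚ(ζ₈)/ℚ` is `{8}`-cyclotomic (LOCAL instance). [folklore] -/
private theorem isCyclotomicExtension_eight_c : IsCyclotomicExtension {8} ℚ K₈ :=
  CyclotomicField.isCyclotomicExtension 8 ℚ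

attribute [local instance] isCyclotomicExtension_four_c isCyclotomicExtension_eight_c
attribute [local instance] GaussianCMCurve.algebraComplex

/-- `2` is a unit of `ℚ(ζ₄)` (LOCAL instance). [folklore] -/
private theorem fact_isUnit_two_c : Fact (IsUnit (2 : K₄)) := ⟨isUnit_iff_ne_zero.mpr two_ne_zero⟩

attribute [local instance] fact_isUnit_two_c

local notation "E" => J1728.abelianVariety (CyclotomicField 4 ℚ)

/-- **Every structure `(E, ι₁)` of type `(ℚ(ζ₄), Ψ)` over `ℚ(ζ₄)` inflates to a structure `(E × E, ι)` of the INDUCED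
type `(ℚ(ζ₈), Ψ^{ℚ(ζ₈)})`** (`ζ₈ ↦ rot₈ = (0 1; ι₁(ζ₄) 0)`, along `j : ζ₄ ↦ ζ₈²`; Shimura §6.2 Thm 3 for `(K; {ψⱼ}) = (ℚ(i), Ψ)`,
`F = ℚ(ζ₈) = K(√2)`, `h = 2`: existence by §5.2 over `k`, identification by the general
`CMSquare.cmType_eq_inducedCMType_of_finrank_eq_two` with `ι(ζ₈²) = ι₁(ζ₄) ⊕ ι₁(ζ₄)`).  These are the two CM types
of `ℚ(ζ₈)` induced from `ℚ(i)`; the two induced from `ℚ(√-2)` (§8.4 Example (2)(A)) would need a curve with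
complex multiplication by `ℤ[√-2]` and are not asserted here. [cite: Shimura1998, §6.2 Theorem 3 (pp. 41–43) and §19.7] -/
theorem exists_isCMTypeRealisationOver_inducedCMType_eight_of {Ψ : CMType K₄} {ι₁ : 𝓞 K₄ →+* End E}
    (h₁ : IsCMTypeRealisationOver Ψ E ι₁) :
    ∃ ι : 𝓞 K₈ →+* End (AbelianVariety.prod E E),
      IsCMTypeRealisationOver (inducedCMType (jEmb : K₄ →ₐ[ℚ] K₈).toRingHom Ψ) (AbelianVariety.prod E E) ι := by
  have hu := comp_self_of_ringHom ι₁
  have haev := aeval_rot8Of_cyclotomic E hu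
  obtain ⟨Φ, hΦ⟩ := exists_isCMTypeRealisationOver_iotaOfCyclotomic (zeta_spec 8 ℚ K₈)
    (AbelianVariety.prod E E) haev two_mul_dim_prod_eq_totient_eight
  refine ⟨iotaOfCyclotomic (zeta_spec 8 ℚ K₈) (AbelianVariety.prod E E) haev, ?_⟩
  have hιa : iotaOfCyclotomic (zeta_spec 8 ℚ K₈) (AbelianVariety.prod E E) haev
      ((zeta_spec 8 ℚ K₈).toInteger ^ 2) = diagEnd E (ι₁ (zeta_spec 4 ℚ K₄).toInteger) := by
    rw [map_pow, iotaOfCyclotomic_toInteger, sq, End.mul_def, rot8Of_comp_rot8Of]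
  have heq := cmType_eq_inducedCMType_of_finrank_eq_two E GaussianCMCurve.finrank_eq_two
    (ringHom_ext_of_apply_eq_of_isCyclotomicExtension (zeta_spec 4 ℚ K₄))
    (jEmb : K₄ →ₐ[ℚ] K₈).toRingHom (a := (zeta_spec 8 ℚ K₈).toInteger ^ 2)
    (by rw [AlgHom.toRingHom_eq_coe, RingHom.coe_coe]; exact jEmb_zeta) hιa h₁ hΦ
  rw [← heq]
  exact hΦ

/-- **For EVERY CM type `Ψ` of `ℚ(ζ₄)`, the induced type `Ψ^{ℚ(ζ₈)}` is realised over `ℚ(ζ₄)` on `E × E`** — both CM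
types of `ℚ(ζ₈)` induced from `ℚ(i)` are types of the square of the Gaussian curve over `ℚ(ζ₄)`.
[cite: Shimura1998, §6.2 Theorem 3 and §8.4 Examples (1), (2)(A)] -/
theorem forall_cmType_exists_isCMTypeRealisationOver_inducedCMType_eight (Ψ : CMType K₄) :
    ∃ ι : 𝓞 K₈ →+* End (AbelianVariety.prod E E),
      IsCMTypeRealisationOver (inducedCMType (jEmb : K₄ →ₐ[ℚ] K₈).toRingHom Ψ) (AbelianVariety.prod E E) ι := by
  obtain ⟨ι₁, h₁⟩ := GaussianCMCurve.exists_isCMTypeRealisationOver_of_cmType Ψ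
  exact exists_isCMTypeRealisationOver_inducedCMType_eight_of h₁

end GaussianCMSquare

end Literature.NumberTheory.ComplexMultiplication

end
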